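import Mathlib
import HarnessLib

/-!
# [OURS · L1 W4.5(b) · EL♮] INERTIA OF FAT TOUCHES (K-INERT): the trace of a relative-threefold centre on the cone germ is
# PRINCIPAL — pure commutative algebra
# (crux `EquisingularLiftNat` = stmt-ResolutionOfSingularities-20038 AS TYPED @ `n = 5`; K5-BMY hatch (d)/(T))

HONEST FRAMING. OURS (cell res-hironaka, crux chain w45b, slot W4.5(b)); NOT a statement of any manuscript; replaces the role
of NOTHING in the manuscript; AI-written, AI review is weaker than expert review. Helper `--supports
stmt-ResolutionOfSingularities-20038 --as helper`. Object K-INERT = res-L1-w45b-strat-1's ASK (STATUS 2026-08-27T08:13:16Z,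
STRATEGY-CENSUS-v3 §2 «INERTIA OF FAT TOUCHES», signature sketch `L/res-L1-w45b-strat-1/Sketch-aniso.lean`), converging with
res-D-brk-4's K5-BMY NOTE 08:13:18Z («useful ⟺ [T] ≠ 0 in Cl(R)») and consumed with `usefulTouch_of_equisingularLiftNat`
(p513560): a centre whose trace ideal on the `H`-germ is principal has blow-up an isomorphism on the germ, so it is never the
finishing touch over `η_S`.

GEOMETRY → ALGEBRA. `R = 𝒪_{X′,x′}` at the point `x′` over `η_S` (Noetherian local, `dim R = 4`); `P` = the prime of the
`H`-germ (`dim R ⧸ P = 2`, NOT regular: the cone over the transversal conic); a FAT TOUCH is a regular `O`-flat relative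
threefold `V(a, b)` through `x′` (`R ⧸ (a, b)` regular of dimension `2`), E1 = «special fibre of the centre inside `V(P)`» =
`P ≤ √(a, b, ϖ)`; ANISOTROPY of the tangent cone, in strat-1's intrinsic form (a): `P + (x)` is prime for every
`x ∈ 𝔪 ∖ (𝔪² + P)`.

RESULTS (sharper than the sketch: anisotropy (b), `ϖ ∈ P`, `ϖ ∉ (a, b)`, the parameter `t` and regularity of `R` are NOT
needed):
* `mem_sup_span_of_conePrime` — CORE: `dim R = 4`, `dim R ⧸ P = 2`, `a ∉ P` with `P + (a)` PRIME, `b, ϖ ∈ 𝔪`,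
  `P ≤ √(a, b, ϖ)` ⟹ `b ∈ P + (a)`. [If not, two non-zero-divisor cuts (`ringKrullDim_quotient_succ_le_of_nonZeroDivisor`)
  give `dim R ⧸ (P + (a, b)) ≤ 0`, so every prime over `(a, b, ϖ) ⊇ …` is `𝔪`, i.e. `𝔪` is minimal over a `3`-generated
  ideal: `height 𝔪 ≤ 3` by Krull's Höhensatz (`Ideal.height_le_spanRank_toENat_of_mem_minimalPrimes`) against
  `height 𝔪 = dim R = 4`.]
* `trace_principal_of_conePrime` — hence the trace `(ā, b̄) ⊂ R ⧸ P` is the principal ideal `(ā)`.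
* `not_mem_or_not_mem_of_not_isRegularLocalRing` — embedding-dimension bookkeeping (Nakayama): if `R ⧸ (a, b)` is regular
  of dimension `2` and `R ⧸ P` is a non-regular `2`-dimensional germ, then `a ∉ 𝔪² + P` or `b ∉ 𝔪² + P`.
* `fatTouchInert` — THE WRAPPER in the sketch's vocabulary: anisotropy (a) + the fat-touch hypotheses ⟹
  `∃ c, (a, b)·(R ⧸ P) = (c)`.

References: Krull's principal ideal / height theorem, Nakayama's lemma (Mathlib `RingTheory.Ideal.KrullsHeightTheorem`,
`RingTheory.Nakayama`); [Matsumura1986, Thm 13.5, Thm 2.2]; L/res-L1-w45b-strat-1/STRATEGY-CENSUS-v3.md §2,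
HOME/D/res-D-brk-4/K5-BMY/NOTES.md §T-USEFUL (OURS planning texts, index only).
-/

set_option linter.dupNamespace false -- mandated namespace `Summit.<Summit>.<Problem>` of this single-conjunct summit

namespace Summit.ResolutionOfSingularities.ResolutionOfSingularities.Cruxes.EquisingularLiftNat.FatTouch

open IsLocalRing Ideal

/-- `WithBot ℕ∞` bookkeeping: `x + 1 ≤ n + 1 ⇒ x ≤ n`. [folklore] -/
theorem withBot_le_of_add_one_le {x : WithBot ℕ∞} {n : ℕ} (h : x + 1 ≤ (n : WithBot ℕ∞) + 1) :
    x ≤ (n : WithBot ℕ∞) := by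
  induction x using WithBot.recBotCoe with
  | bot => exact bot_le
  | coe m =>
    have h' : (m : WithBot ℕ∞) + 1 = ((m + 1 : ℕ∞) : WithBot ℕ∞) := by norm_cast
    have h'' : (n : WithBot ℕ∞) + 1 = ((n + 1 : ℕ∞) : WithBot ℕ∞) := by norm_cast
    rw [h', h''] at h
    have h3 : (m : ℕ∞) + 1 ≤ (n : ℕ∞) + 1 := by exact_mod_cast h
    have h4 : (m : ℕ∞) ≤ n := (WithTop.add_le_add_iff_right WithTop.one_ne_top).mp h3
    exact_mod_cast h4

/-- Cutting a local domain quotient by a non-zero element lowers the Krull dimension: if `R ⧸ P` (`P` prime) has dimension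
`≤ n + 1` and `a ∉ P`, then `R ⧸ (P ⊔ (a))` has dimension `≤ n`. [folklore; Krull] -/
theorem ringKrullDim_quotient_sup_span_le {R : Type*} [CommRing R] {P : Ideal R} [hP : P.IsPrime] {a : R}
    (haP : a ∉ P) {n : ℕ} (hPdim : ringKrullDim (R ⧸ P) ≤ (n : WithBot ℕ∞) + 1) :
    ringKrullDim (R ⧸ (P ⊔ Ideal.span {a})) ≤ (n : WithBot ℕ∞) := by
  have ha0 : Ideal.Quotient.mk P a ≠ 0 := by
    rwa [Ne, Ideal.Quotient.eq_zero_iff_mem]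
  have h1 := ringKrullDim_quotient_succ_le_of_nonZeroDivisor (mem_nonZeroDivisors_of_ne_zero ha0)
  have hspan : Ideal.span {Ideal.Quotient.mk P a} = (Ideal.span {a}).map (Ideal.Quotient.mk P) := by
    rw [Ideal.map_span, Set.image_singleton]
  have e : ((R ⧸ P) ⧸ Ideal.span {Ideal.Quotient.mk P a}) ≃+* R ⧸ (P ⊔ Ideal.span {a}) :=
    (Ideal.quotEquivOfEq hspan).trans (DoubleQuot.quotQuotEquivQuotSup P (Ideal.span {a}))
  rw [← ringKrullDim_eq_of_ringEquiv e]
  exact withBot_le_of_add_one_le (h1.trans hPdim)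

/-- **K-INERT, core.** Let `R` be a Noetherian local ring of Krull dimension `4`, `P` a prime with `dim R ⧸ P = 2` (the
`H`-germ at the point over `η_S`: a surface germ over `k(S)`), `a ∉ P` such that `P ⊔ (a)` is PRIME (anisotropy of the
tangent cone at the generator not in `P + 𝔪²`), `b, ϖ ∈ 𝔪`, and E1 in the form `P ≤ √(a, b, ϖ)` (the special fibre of the
centre `V(a, b)` lies on the germ `V(P)`). Then `b ∈ P ⊔ (a)`: otherwise two non-zero-divisor cuts bring `dim R ⧸ (P + (a, b))`
down to `0`, so the maximal ideal is minimal over the `3`-generated ideal `(a, b, ϖ)` and has height `≤ 3` by Krull's height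
theorem, against `height 𝔪 = dim R = 4`. [folklore; Krull's Hauptidealsatz] -/
theorem mem_sup_span_of_conePrime {R : Type*} [CommRing R] [IsLocalRing R] [IsNoetherianRing R]
    (hdim : ringKrullDim R = 4) {P : Ideal R} [hP : P.IsPrime] (hPdim : ringKrullDim (R ⧸ P) = 2)
    {a b ϖ : R} (haP : a ∉ P) (hQ : (P ⊔ Ideal.span {a}).IsPrime)
    (hb : b ∈ maximalIdeal R) (hϖ : ϖ ∈ maximalIdeal R)
    (hE1 : P ≤ (Ideal.span {a, b, ϖ}).radical) :
    b ∈ P ⊔ Ideal.span {a} := by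
  by_contra hbQ
  set Q := P ⊔ Ideal.span {a} with hQdef
  haveI : Q.IsPrime := hQ
  -- (1) two cuts: `dim R/Q ≤ 1`, `dim R/(Q ⊔ (b)) ≤ 0`
  have hB : ringKrullDim (R ⧸ Q) ≤ ((1 : ℕ) : WithBot ℕ∞) :=
    ringKrullDim_quotient_sup_span_le haP (n := 1) (by rw [hPdim]; norm_num)
  have hC : ringKrullDim (R ⧸ (Q ⊔ Ideal.span {b})) ≤ ((0 : ℕ) : WithBot ℕ∞) :=
    ringKrullDim_quotient_sup_span_le hbQ (n := 0) (by simpa using hB)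
  set Q₂ := Q ⊔ Ideal.span {b} with hQ₂def
  -- (2) `Q₂ ≤ 𝔪`, so `R ⧸ Q₂` is a non-trivial ring of dimension `≤ 0`
  have hQm : Q ≤ maximalIdeal R := IsLocalRing.le_maximalIdeal hQ.ne_top
  have hQ₂m : Q₂ ≤ maximalIdeal R :=
    sup_le hQm ((Ideal.span_singleton_le_iff_mem _).mpr hb)
  have hQ₂top : Q₂ ≠ ⊤ := fun h => (maximalIdeal.isMaximal R).ne_top (top_le_iff.mp (h ▸ hQ₂m))
  haveI : Nontrivial (R ⧸ Q₂) := Ideal.Quotient.nontrivial_iff.mpr hQ₂top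
  haveI : Ring.KrullDimLE 0 (R ⧸ Q₂) := by
    rw [Ring.KrullDimLE, Order.krullDimLE_iff]
    change ringKrullDim (R ⧸ Q₂) ≤ 0
    simpa using hC
  -- (3) the maximal ideal is a minimal prime of `I = (a, b, ϖ)`
  set I : Ideal R := Ideal.span {a, b, ϖ} with hIdef
  have haQ : a ∈ Q := Ideal.mem_sup_right (Ideal.subset_span rfl)
  have hIm : I ≤ maximalIdeal R := by
    rw [hIdef, Ideal.span_le]
    rintro x (rfl | rfl | rfl)
    · exact hQm haQ
    · exact hb
    · exact hϖ
  have hmin : maximalIdeal R ∈ I.minimalPrimes := by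
    refine ⟨⟨(maximalIdeal.isMaximal R).isPrime, hIm⟩, fun q hq hqm => ?_⟩
    obtain ⟨hqp, hIq⟩ := hq
    haveI := hqp
    have hPq : P ≤ q := hE1.trans (hqp.radical_le_iff.mpr hIq)
    have haq : a ∈ q := hIq (Ideal.subset_span (by simp))
    have hbq : b ∈ q := hIq (Ideal.subset_span (by simp))
    have hQ₂q : Q₂ ≤ q :=
      sup_le (sup_le hPq ((Ideal.span_singleton_le_iff_mem _).mpr haq))
        ((Ideal.span_singleton_le_iff_mem _).mpr hbq)
    -- `q / Q₂` is prime in a zero-dimensional ring, hence maximal; so `q` is maximal, `q = 𝔪`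
    have hker : RingHom.ker (Ideal.Quotient.mk Q₂) ≤ q := by rwa [Ideal.mk_ker]
    haveI hq' : (q.map (Ideal.Quotient.mk Q₂)).IsPrime :=
      Ideal.map_isPrime_of_surjective Ideal.Quotient.mk_surjective hker
    haveI : (q.map (Ideal.Quotient.mk Q₂)).IsMaximal := hq'.isMaximal'
    have hqmax : (Ideal.comap (Ideal.Quotient.mk Q₂) (q.map (Ideal.Quotient.mk Q₂))).IsMaximal :=
      Ideal.comap_isMaximal_of_surjective _ Ideal.Quotient.mk_surjective
    rw [Ideal.comap_map_of_surjective _ Ideal.Quotient.mk_surjective, ← RingHom.ker_eq_comap_bot,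
      Ideal.mk_ker, sup_eq_left.mpr hQ₂q] at hqmax
    exact (IsLocalRing.eq_maximalIdeal hqmax).ge
  -- (4) Krull's height theorem: `height 𝔪 ≤ 3`, but `height 𝔪 = dim R = 4`
  have h1 := Ideal.height_le_spanRank_toENat_of_mem_minimalPrimes I _ hmin
  have hfg : ((I.spanFinrank : ℕ) : ℕ∞) = I.spanRank.toENat := by
    rw [Submodule.fg_iff_spanRank_eq_spanFinrank.mpr (IsNoetherian.noetherian I), map_natCast]
  have hcard : I.spanFinrank ≤ 3 := by
    refine (Submodule.spanFinrank_span_le_ncard_of_finite (Set.toFinite _)).trans ?_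
    calc ({a, b, ϖ} : Set R).ncard ≤ ({b, ϖ} : Set R).ncard + 1 := Set.ncard_insert_le _ _
      _ ≤ (({ϖ} : Set R).ncard + 1) + 1 := by gcongr; exact Set.ncard_insert_le _ _
      _ = 3 := by rw [Set.ncard_singleton]
  have h2 : (maximalIdeal R).height ≤ 3 := by
    refine h1.trans ?_
    rw [← hfg]
    exact_mod_cast hcard
  have h3 : ((maximalIdeal R).height : WithBot ℕ∞) = 4 := by
    rw [IsLocalRing.maximalIdeal_height_eq_ringKrullDim, hdim]
  have h4 : (maximalIdeal R).height = 4 := by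
    have : ((maximalIdeal R).height : WithBot ℕ∞) = ((4 : ℕ∞) : WithBot ℕ∞) := by rw [h3]; rfl
    exact WithBot.coe_injective this
  rw [h4] at h2
  exact absurd h2 (by decide)

/-- **K-INERT: the trace is principal.** In the setting of `mem_sup_span_of_conePrime`, the image of the centre ideal
`(a, b)` in the germ `R ⧸ P` is the principal ideal `(ā)` — so blowing up the centre does not change the germ `V(P)` near
the point (a FAT TOUCH is never the finishing touch; consumed with `usefulTouch_of_equisingularLiftNat`). [folklore] -/
theorem trace_principal_of_conePrime {R : Type*} [CommRing R] [IsLocalRing R] [IsNoetherianRing R]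
    (hdim : ringKrullDim R = 4) {P : Ideal R} [hP : P.IsPrime] (hPdim : ringKrullDim (R ⧸ P) = 2)
    {a b ϖ : R} (haP : a ∉ P) (hQ : (P ⊔ Ideal.span {a}).IsPrime)
    (hb : b ∈ maximalIdeal R) (hϖ : ϖ ∈ maximalIdeal R)
    (hE1 : P ≤ (Ideal.span {a, b, ϖ}).radical) :
    Ideal.map (Ideal.Quotient.mk P) (Ideal.span {a, b}) = Ideal.span {Ideal.Quotient.mk P a} := by
  have hbQ := mem_sup_span_of_conePrime hdim hPdim haP hQ hb hϖ hE1
  rw [Ideal.map_span, Set.image_insert_eq, Set.image_singleton]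
  apply le_antisymm
  · rw [Ideal.span_le]
    rintro x (rfl | rfl)
    · exact Ideal.subset_span rfl
    · -- `b = p + r a` with `p ∈ P`
      obtain ⟨p, hp, s, hs, hps⟩ := Submodule.mem_sup.mp hbQ
      obtain ⟨r, rfl⟩ := Ideal.mem_span_singleton'.mp hs
      have : Ideal.Quotient.mk P b = Ideal.Quotient.mk P r * Ideal.Quotient.mk P a := by
        rw [← map_mul, ← hps, map_add, Ideal.Quotient.eq_zero_iff_mem.mpr hp, zero_add]
      rw [SetLike.mem_coe, this]
      exact Ideal.mul_mem_left _ _ (Ideal.subset_span rfl)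
  · exact Ideal.span_mono (Set.singleton_subset_iff.mpr (Set.mem_insert _ _))


/-! ## The geometric wrapper: one of the two generators of the centre is outside `P + 𝔪²` -/

/-- **Embedding-dimension bookkeeping.** If `R ⧸ (a, b)` is a regular local ring of dimension `2` and BOTH `a, b ∈ P + 𝔪²`,
then the maximal ideal of `R ⧸ P` is generated by `2` elements (lifts of the two generators of `𝔪 / (a, b)`, by Nakayama),
so `R ⧸ P` is regular as soon as `dim R ⧸ P = 2`. Contrapositive used below: for a NON-regular `2`-dimensional germ `R ⧸ P`
one of `a, b` lies outside `P + 𝔪²`. [folklore; Nakayama] -/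
theorem not_mem_or_not_mem_of_not_isRegularLocalRing {R : Type*} [CommRing R] [IsLocalRing R] [IsNoetherianRing R]
    {P : Ideal R} [hP : P.IsPrime] (hPdim : ringKrullDim (R ⧸ P) = 2) (hPreg : ¬ IsRegularLocalRing (R ⧸ P))
    {a b : R} (hab : IsRegularLocalRing (R ⧸ Ideal.span {a, b})) (habdim : ringKrullDim (R ⧸ Ideal.span {a, b}) = 2) :
    a ∉ (maximalIdeal R) ^ 2 ⊔ P ∨ b ∉ (maximalIdeal R) ^ 2 ⊔ P := by
  classical
  by_contra h
  push Not at h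
  obtain ⟨haP2, hbP2⟩ := h
  apply hPreg
  set J : Ideal R := Ideal.span {a, b} with hJ
  -- two generators of the maximal ideal of `R ⧸ J`
  have hfg : (maximalIdeal (R ⧸ J)).FG := IsNoetherian.noetherian _
  obtain ⟨s, hs_card, hs_span⟩ := Submodule.FG.exists_span_finset_card_eq_spanFinrank hfg
  have hs2 : s.card = 2 := by
    have h1 := hab.spanFinrank_maximalIdeal
    rw [habdim] at h1
    have h2 : ((maximalIdeal (R ⧸ J)).spanFinrank : WithBot ℕ∞) = ((2 : ℕ) : WithBot ℕ∞) := by rw [h1]; rfl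
    rw [hs_card]
    exact_mod_cast h2
  -- lift them to `R`
  obtain ⟨g, hg⟩ : ∃ g : R ⧸ J → R, ∀ y, Ideal.Quotient.mk J (g y) = y :=
    ⟨Function.surjInv Ideal.Quotient.mk_surjective, Function.surjInv_eq Ideal.Quotient.mk_surjective⟩
  set L : Set R := g '' (s : Set (R ⧸ J)) with hL
  have hLfin : L.Finite := s.finite_toSet.image g
  have hLcard : L.ncard ≤ 2 := by
    refine (Set.ncard_image_le s.finite_toSet).trans ?_
    rw [Set.ncard_coe_finset, hs2]
  have hmkL : (Ideal.Quotient.mk J) '' L = (s : Set (R ⧸ J)) := by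
    ext y
    simp only [hL, Set.image_image, hg, Set.image_id', Finset.mem_coe]
  haveI : IsLocalHom (Ideal.Quotient.mk J) := IsLocalHom.of_surjective _ Ideal.Quotient.mk_surjective
  have hLm : L ⊆ (maximalIdeal R : Set R) := by
    rintro _ ⟨y, hy, rfl⟩
    have hy' : Ideal.Quotient.mk J (g y) ∈ maximalIdeal (R ⧸ J) := by
      rw [hg, ← hs_span]; exact Submodule.subset_span hy
    have : g y ∈ (maximalIdeal (R ⧸ J)).comap (Ideal.Quotient.mk J) := hy'
    rwa [IsLocalRing.maximalIdeal_comap] at this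
  -- `𝔪 ≤ J ⊔ (L)`
  have hmL : maximalIdeal R ≤ J ⊔ Ideal.span L := by
    intro m hm
    have h1 : Ideal.Quotient.mk J m ∈ maximalIdeal (R ⧸ J) := _root_.map_nonunit (Ideal.Quotient.mk J) m hm
    have h2 : maximalIdeal (R ⧸ J) = (Ideal.span L).map (Ideal.Quotient.mk J) := by
      rw [Ideal.map_span, hmkL, ← hs_span]
    rw [h2] at h1
    have h3 : m ∈ Ideal.comap (Ideal.Quotient.mk J) ((Ideal.span L).map (Ideal.Quotient.mk J)) := h1
    rwa [Ideal.comap_map_of_surjective _ Ideal.Quotient.mk_surjective, ← RingHom.ker_eq_comap_bot,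
      Ideal.mk_ker, sup_comm] at h3
  have hJle : J ≤ (maximalIdeal R) ^ 2 ⊔ P := by
    rw [hJ, Ideal.span_le]
    rintro x (rfl | rfl)
    · exact haP2
    · exact hbP2
  have hm2 : maximalIdeal R ≤ ((maximalIdeal R) ^ 2 ⊔ P) ⊔ Ideal.span L :=
    hmL.trans (sup_le_sup_right hJle _)
  -- push to `A = R ⧸ P` and apply Nakayama
  haveI : Nontrivial (R ⧸ P) := Ideal.Quotient.nontrivial_iff.mpr hP.ne_top
  haveI : IsLocalRing (R ⧸ P) := IsLocalRing.of_surjective' (Ideal.Quotient.mk P) Ideal.Quotient.mk_surjective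
  have h𝔫 : (maximalIdeal R).map (Ideal.Quotient.mk P) = maximalIdeal (R ⧸ P) :=
    IsLocalRing.map_maximalIdeal_of_surjective _ Ideal.Quotient.mk_surjective
  set N : Ideal (R ⧸ P) := Ideal.span (Ideal.Quotient.mk P '' L) with hN
  have hNle : N ≤ maximalIdeal (R ⧸ P) := by
    rw [hN, Ideal.span_le, ← h𝔫]
    rintro _ ⟨ℓ, hℓ, rfl⟩
    exact Ideal.mem_map_of_mem _ (hLm hℓ)
  have hle : maximalIdeal (R ⧸ P) ≤ N ⊔ maximalIdeal (R ⧸ P) • maximalIdeal (R ⧸ P) := by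
    have h := Ideal.map_mono (f := Ideal.Quotient.mk P) hm2
    rw [Ideal.map_sup, Ideal.map_sup, Ideal.map_pow, h𝔫, Ideal.map_quotient_self, Ideal.map_span] at h
    rw [smul_eq_mul, ← pow_two]
    simpa [hN, sup_comm] using h
  have hfin : (maximalIdeal (R ⧸ P)).FG := IsNoetherian.noetherian _
  have hmN : maximalIdeal (R ⧸ P) ≤ N :=
    Submodule.le_of_le_smul_of_le_jacobson_bot hfin (IsLocalRing.maximalIdeal_le_jacobson _) hle
  have heq : maximalIdeal (R ⧸ P) = N := le_antisymm hmN hNle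
  -- two generators and dimension two: regular
  refine IsRegularLocalRing.of_spanFinrank_maximalIdeal_le _ ?_
  rw [hPdim, heq, hN]
  have : (Ideal.span (Ideal.Quotient.mk P '' L)).spanFinrank ≤ 2 :=
    (Submodule.spanFinrank_span_le_ncard_of_finite (hLfin.image _)).trans
      ((Set.ncard_image_le hLfin).trans hLcard)
  exact_mod_cast this

/-- **INERTIA OF FAT TOUCHES (K-INERT, geometric wrapper).** `R` a Noetherian local ring of dimension `4` (the ambient germ
`𝒪_{X′,x′}` at the point `x′` over `η_S`), `P` a prime with `R ⧸ P` of dimension `2` and NOT regular (the `H`-germ: the cone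
over the transversal conic), ANISOTROPY in res-L1-w45b-strat-1's form (a): `P ⊔ (x)` is prime for every `x ∈ 𝔪 ∖ (𝔪² + P)`,
and a relative-threefold centre `V(a, b)` through the point: `R ⧸ (a, b)` regular of dimension `2`, `a, b, ϖ ∈ 𝔪`, E1 as
`P ≤ √(a, b, ϖ)`. Then the trace of `(a, b)` on `R ⧸ P` is PRINCIPAL (generated by the image of the generator outside
`P + 𝔪²`). Not needed (cf. strat-1's `FatTouchInert` signature): anisotropy (b), `ϖ ∈ P`, `ϖ ∉ (a, b)`, `t`, regularity of
`R`. Consumed with `usefulTouch_of_equisingularLiftNat` (p513560): a centre with principal trace is never the finishing touch.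
[folklore; Krull, Nakayama] -/
theorem fatTouchInert {R : Type*} [CommRing R] [IsLocalRing R] [IsNoetherianRing R]
    (hdim : ringKrullDim R = 4) {P : Ideal R} [hP : P.IsPrime] (hPdim : ringKrullDim (R ⧸ P) = 2)
    (hPreg : ¬ IsRegularLocalRing (R ⧸ P))
    (haniso : ∀ x : R, x ∈ maximalIdeal R → x ∉ (maximalIdeal R) ^ 2 ⊔ P → (P ⊔ Ideal.span {x}).IsPrime)
    {a b ϖ : R} (ha : a ∈ maximalIdeal R) (hb : b ∈ maximalIdeal R) (hϖ : ϖ ∈ maximalIdeal R)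
    (hab : IsRegularLocalRing (R ⧸ Ideal.span {a, b})) (habdim : ringKrullDim (R ⧸ Ideal.span {a, b}) = 2)
    (hE1 : P ≤ (Ideal.span {a, b, ϖ}).radical) :
    ∃ c : R ⧸ P, Ideal.map (Ideal.Quotient.mk P) (Ideal.span {a, b}) = Ideal.span {c} := by
  rcases not_mem_or_not_mem_of_not_isRegularLocalRing hPdim hPreg hab habdim with haP2 | hbP2
  · have haP : a ∉ P := fun h => haP2 (Ideal.mem_sup_right h)
    exact ⟨_, trace_principal_of_conePrime hdim hPdim haP (haniso a ha haP2) hb hϖ hE1⟩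
  · have hbP : b ∉ P := fun h => hbP2 (Ideal.mem_sup_right h)
    have hE1' : P ≤ (Ideal.span {b, a, ϖ}).radical := by rwa [Set.insert_comm]
    refine ⟨Ideal.Quotient.mk P b, ?_⟩
    rw [Set.pair_comm]
    exact trace_principal_of_conePrime hdim hPdim hbP (haniso b hb hbP2) ha hϖ hE1'

end Summit.ResolutionOfSingularities.ResolutionOfSingularities.Cruxes.EquisingularLiftNat.FatTouch
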